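import Summits.BirchSwinnertonDyer.BirchSwinnertonDyer.Theorems.KatoDescentPotSupersingularWildUpperUnitTwistRecordsSharpTam07
import Summits.BirchSwinnertonDyer.BirchSwinnertonDyer.Theorems.KatoDescentPotSupersingularWildUpperUnitTwistRecordsSharpTam08
import Literature.NumberTheory.EllipticCurves.ModThreeImageCubeDiscriminantProofs
import HarnessLib

/-!
# Route `KatoDescentPotSupersingular` (rung K9, sub-rung B5 = O6 wild `p = 3`, cell `bsd-potss`): MOD-3 IMAGE KERNEL UPGRADE of the ♯
# unit-twist records on the CARTAN rows — «`ρ̄_(E,3)` NOT onto» IN THE KERNEL from `Δ(E)` being a CUBE, so that the displayed binder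
# `hns` (3-adic tower not onto) is DISCHARGED on top of the Tamagawa upgrade (part 05: 202554u1@3, 228150bz1@3, 237600el1@3, 241758cd1@3, 241758ck1@3, 249615i1@3)
# (seat `bsd-potss-k9-c4` g17; `--supports stmt-BirchSwinnertonDyer-19197 --as helper`)

HONEST FRAMING. THEOREMS ONLY (no definition, no named fact, no `sorry`); PER PAIR; nothing booked; items 19189 / 19197 / 21422 stay
OPEN class-wide; BSD is not proved for any class.  The ♯ records display `hns : ¬ ∀ n, ρ̄_(E,3ⁿ) onto` — the row's mod-3 image
type (normaliser of a split / non-split Cartan) was so far a CENSUS DATUM (conjA-anchor g9 ROW-STATUS / kmc g21), not re-derived.  On a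
Cartan row the mod-3 image has order prime to 3, so `ℚ(∛Δ) ⊂ ℚ(E[3])` (Serre 1972 §5.3) forces `Δ(E) ∈ ℚ׳`; conversely the tree
THEOREM `ModThreeImage.not_hasSurjectiveModNGaloisRep_three_of_Δ_eq_cube` (`Literature/…/ModThreeImageCubeDiscriminantProofs`, PROVED,
no named fact) gives `Δ = s³ ⟹ ρ̄_(E,3)` not surjective, hence `hns`.  Per row below: `notSurjThree_g<label>` (`Δ(E₀) = s³` for the
literal integral model, `decide +kernel` + `norm_num`) and `missingUpperBoundAt_g<label>_3_img` = the Tamagawa-upgraded record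
`missingUpperBoundAt_g<label>_3_tam` (files `…RecordsSharpTamNN`, this seat) with `hns` REMOVED as well.  After this upgrade a ♯ record's
displayed row data are: the named facts + the schema, Cremona's `N`, `r_an = 0`, the lattice-optimal datum with `3 ∤ c(D)`, the field,
and the twist numerics — the image type and the Tamagawa data are kernel facts.  (The 9-deficient rows — `GL₂(𝔽₃)` onto mod 3, tower not
onto mod 9 — are NOT covered: `Δ` is not a cube there; their `hns` stays displayed.)

References: [Serre1972] §5.3; [SilvermanAEC2009] III.1, VII.1 Rem. 1.1; [Zywina2015ModL] §1 (images of ρ̄_(E,3)); [Jetchev2008] Cor. 1.5;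
[Miller2011LMS] Def. 1.1; [Cremona2006] Table 1.
-/

set_option autoImplicit false
set_option linter.dupNamespace false
noncomputable section
open scoped Classical NumberField
open WeierstrassCurve NumberField Field
  Literature.NumberTheory.EllipticCurves
  Literature.NumberTheory.EllipticCurves.ModularForms Literature.NumberTheory.EllipticCurves.Rank1Residual
  Literature.NumberTheory.EllipticCurves.Rank1Residual.Typed Literature.NumberTheory.Automorphic
  Literature.NumberTheory.EllipticCurves.Rank1Residual.X11RankOneCertificates
  Summit.BirchSwinnertonDyer.BirchSwinnertonDyer.Rank1Residual.IntModel
  Summit.BirchSwinnertonDyer.BirchSwinnertonDyer.Rank1Residual.X11RankOne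
  Summit.BirchSwinnertonDyer.Rank1Residual Summit.BirchSwinnertonDyer.Rank1Residual.Additive
  Summit.BirchSwinnertonDyer.BirchSwinnertonDyer.Theorems

namespace Summit.BirchSwinnertonDyer.BirchSwinnertonDyer.Theorems.WildUpperUnitTwistRecords

/-! ### `202554u1`: `Δ = 399598997884416 = (73656)³` — mod-3 image inside a Cartan normaliser, certified in the kernel -/

/-- **`ρ̄_(E,3)` is NOT surjective for `E = 202554u1`** (kernel: `Δ(E) = (73656)³` on the integral model `[1, -1, 1, -43121, 3320353]`; Serre: `ℚ(E[3]) ⊇ ℚ(μ₃, ∛Δ)`, so a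
surjective image forces `Δ ∉ ℚ׳`; tree THEOREM `ModThreeImage.not_hasSurjectiveModNGaloisRep_three_of_Δ_eq_cube`). [cite: Serre1972, §5.3]
[cite: SilvermanAEC2009, III.1] [cite: Cremona2006, Table 1 (Cremona label 202554u1)] -/
theorem notSurjThree_g202554u1 {W : WeierstrassCurve ℚ} [W.IsElliptic] [W.IsGloballyMinimal]
    (hI : integralModelInt W = (⟨1, -1, 1, -43121, 3320353⟩ : WeierstrassCurve ℤ)) : ¬ W.HasSurjectiveModNGaloisRep 3 := by
  have hD : discOf [1, (-1), 1, (-43121), 3320353] = 399598997884416 := by decide +kernel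
  have hΔ : W.Δ = ((399598997884416 : ℤ) : ℚ) := by rw [Δ_eq_cast hI, intCurve_Δ, hD]
  exact ModThreeImage.not_hasSurjectiveModNGaloisRep_three_of_Δ_eq_cube W (d := ((73656 : ℤ) : ℚ)) (by rw [hΔ]; norm_num)

/-- **RECORD `202554u1` @ `3` with the image binder `hns` AND the Tamagawa binders DISCHARGED** — `missingUpperBoundAt_g202554u1_3_tam` (file
`…RecordsSharpTam07`) with `hns` supplied by `notSurjThree_g202554u1` (`n = 1`). Remaining displayed: named facts + schema, Cremona's `N`, `r_an = 0`,
the lattice-optimal datum with `3 ∤ c(D)`, the field, the twist numerics. Per pair; nothing booked; BSD is not proved by this.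
[cite: Serre1972, §5.3] [cite: Jetchev2008, Cor. 1.5] [cite: Miller2011LMS, Def. 1.1] [cite: Cremona2006, Table 1 (Cremona label 202554u1)] -/
theorem missingUpperBoundAt_g202554u1_3_img
    (hGZ : ∀ (N : ℕ) [NeZero N] (W : WeierstrassCurve ℚ) (K : Type) [Field K] [NumberField K],
      gross_zagier N W K)
    (hKo : ∀ (N : ℕ) [NeZero N] (W : WeierstrassCurve ℚ) (K : Type) [Field K] [NumberField K],
      kolyvagin N W K)
    (hMN : ∀ (N : ℕ) [NeZero N] (W : WeierstrassCurve ℚ) (K : Type) [Field K] [NumberField K],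
      MatarNekovar2019.thm03_padicValNat_card_sha_le_of_irreducible N W K)
    (hGZK : rank_eq_analyticRank_of_analyticRank_le_one) (hmod : hasEntireLFunction_rat)
    (hJ2 : ∀ (N : ℕ) [NeZero N] (W : WeierstrassCurve ℚ) [W.IsElliptic] [W.IsGloballyMinimal]
      (K : Type) [Field K] [NumberField K],
      IsImaginaryQuadratic K → NumberField.discr K ≠ -3 → NumberField.discr K ≠ -4 →
      SatisfiesHeegnerHypothesis N K → SatisfiesHeegnerHypothesis 2 K →
      ∀ (p : ℕ) [Fact p.Prime], p ≠ 2 → W.analyticRank = 0 → Addv W p → 0 ≤ padicValRat p W.j →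
      ¬ W.HasCM → W.HasIrreducibleModPGaloisRep p →
      ¬ (∀ n : ℕ, W.HasSurjectiveModNGaloisRep (p ^ n : ℕ)) →
      (∃ Dt : ModularParametrizationData W N,
        (∀ z ∈ Dt.L.lattice, ∃ w ∈ periodLattice Dt.f, z = (Dt.c : ℂ) * w) ∧ ¬ (p : ℤ) ∣ Dt.c) →
      ¬ p ∣ (W.baseChange ℚ_[p]).localTamagawaNumber ℤ_[p] →
      (∀ (q' : ℕ) [Fact q'.Prime], q' ∣ N →
        p ∣ (W.baseChange ℚ_[q']).localTamagawaNumber ℤ_[q'] → ¬ q' ^ 2 ∣ N) →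
      ∀ {P : (W.baseChange K).toAffine.Point}, IsHeegnerPoint N W K P → ¬ IsOfFinAddOrder P →
      ∀ (q : ℕ) [Fact q.Prime], q ∣ N → ¬ q ^ 2 ∣ N → q ≠ p →
      padicValNat p (Nat.card (AddCommGroup.primaryComponent (W.baseChange K).sha p)) +
          2 * padicValNat p ((W.baseChange ℚ_[q]).localTamagawaNumber ℤ_[q]) ≤
        2 * padicValNat p (AddSubgroup.zmultiples P).index)
    {W : WeierstrassCurve ℚ} [W.IsElliptic] [W.IsGloballyMinimal] (hWeq : W = (⟨1, (-1), 1, (-43121), 3320353⟩ : WeierstrassCurve ℚ))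
    (hN : W.conductorNorm ℤ = 202554) (hr : W.analyticRank = 0)
    (D : ModularParametrizationData W 202554) (hopt : ∀ z ∈ D.L.lattice, ∃ w ∈ periodLattice D.f, z = (D.c : ℂ) * w)
    (hc : ¬ (3 : ℤ) ∣ D.c)
    (K : Type) [Field K] [NumberField K] (hK : IsImaginaryQuadratic K) (hdK : NumberField.discr K = -167)
    {Wd : WeierstrassCurve ℚ} [Wd.IsElliptic] [Wd.IsGloballyMinimal] (hWdeq : Wd = (⟨1, (-1), 1, (-1202592854), (-15413913581723)⟩ : WeierstrassCurve ℚ))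
    (hrd : Wd.analyticRank = 1) {qd : ℚ} (hqd : shaAn Wd = (qd : ℂ)) (hvd : padicValRat 3 qd ≤ 0) :
    MissingUpperBoundAt W 3 := by
  have hI : integralModelInt W = (⟨1, -1, 1, -43121, 3320353⟩ : WeierstrassCurve ℤ) := by
    subst hWeq; exact integralModelInt_eq_of_map_eq _ (map_mk_int 1 (-1) 1 (-43121) 3320353)
  have hns : ¬ (∀ n : ℕ, W.HasSurjectiveModNGaloisRep (3 ^ n : ℕ)) := fun h =>
    notSurjThree_g202554u1 hI (by simpa using h 1)
  exact missingUpperBoundAt_g202554u1_3_tam hGZ hKo hMN hGZK hmod hJ2 hWeq hN hr hns D hopt hc K hK hdK hWdeq hrd hqd hvd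

/-! ### `228150bz1`: `Δ = 2290571864568000000 = (1318200)³` — mod-3 image inside a Cartan normaliser, certified in the kernel -/

/-- **`ρ̄_(E,3)` is NOT surjective for `E = 228150bz1`** (kernel: `Δ(E) = (1318200)³` on the integral model `[1, -1, 1, -463430, 97290197]`; Serre: `ℚ(E[3]) ⊇ ℚ(μ₃, ∛Δ)`, so a
surjective image forces `Δ ∉ ℚ׳`; tree THEOREM `ModThreeImage.not_hasSurjectiveModNGaloisRep_three_of_Δ_eq_cube`). [cite: Serre1972, §5.3]
[cite: SilvermanAEC2009, III.1] [cite: Cremona2006, Table 1 (Cremona label 228150bz1)] -/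
theorem notSurjThree_g228150bz1 {W : WeierstrassCurve ℚ} [W.IsElliptic] [W.IsGloballyMinimal]
    (hI : integralModelInt W = (⟨1, -1, 1, -463430, 97290197⟩ : WeierstrassCurve ℤ)) : ¬ W.HasSurjectiveModNGaloisRep 3 := by
  have hD : discOf [1, (-1), 1, (-463430), 97290197] = 2290571864568000000 := by decide +kernel
  have hΔ : W.Δ = ((2290571864568000000 : ℤ) : ℚ) := by rw [Δ_eq_cast hI, intCurve_Δ, hD]
  exact ModThreeImage.not_hasSurjectiveModNGaloisRep_three_of_Δ_eq_cube W (d := ((1318200 : ℤ) : ℚ)) (by rw [hΔ]; norm_num)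

/-- **RECORD `228150bz1` @ `3` with the image binder `hns` AND the Tamagawa binders DISCHARGED** — `missingUpperBoundAt_g228150bz1_3_tam` (file
`…RecordsSharpTam07`) with `hns` supplied by `notSurjThree_g228150bz1` (`n = 1`). Remaining displayed: named facts + schema, Cremona's `N`, `r_an = 0`,
the lattice-optimal datum with `3 ∤ c(D)`, the field, the twist numerics. Per pair; nothing booked; BSD is not proved by this.
[cite: Serre1972, §5.3] [cite: Jetchev2008, Cor. 1.5] [cite: Miller2011LMS, Def. 1.1] [cite: Cremona2006, Table 1 (Cremona label 228150bz1)] -/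
theorem missingUpperBoundAt_g228150bz1_3_img
    (hGZ : ∀ (N : ℕ) [NeZero N] (W : WeierstrassCurve ℚ) (K : Type) [Field K] [NumberField K],
      gross_zagier N W K)
    (hKo : ∀ (N : ℕ) [NeZero N] (W : WeierstrassCurve ℚ) (K : Type) [Field K] [NumberField K],
      kolyvagin N W K)
    (hMN : ∀ (N : ℕ) [NeZero N] (W : WeierstrassCurve ℚ) (K : Type) [Field K] [NumberField K],
      MatarNekovar2019.thm03_padicValNat_card_sha_le_of_irreducible N W K)
    (hGZK : rank_eq_analyticRank_of_analyticRank_le_one) (hmod : hasEntireLFunction_rat)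
    (hJ2 : ∀ (N : ℕ) [NeZero N] (W : WeierstrassCurve ℚ) [W.IsElliptic] [W.IsGloballyMinimal]
      (K : Type) [Field K] [NumberField K],
      IsImaginaryQuadratic K → NumberField.discr K ≠ -3 → NumberField.discr K ≠ -4 →
      SatisfiesHeegnerHypothesis N K → SatisfiesHeegnerHypothesis 2 K →
      ∀ (p : ℕ) [Fact p.Prime], p ≠ 2 → W.analyticRank = 0 → Addv W p → 0 ≤ padicValRat p W.j →
      ¬ W.HasCM → W.HasIrreducibleModPGaloisRep p →
      ¬ (∀ n : ℕ, W.HasSurjectiveModNGaloisRep (p ^ n : ℕ)) →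
      (∃ Dt : ModularParametrizationData W N,
        (∀ z ∈ Dt.L.lattice, ∃ w ∈ periodLattice Dt.f, z = (Dt.c : ℂ) * w) ∧ ¬ (p : ℤ) ∣ Dt.c) →
      ¬ p ∣ (W.baseChange ℚ_[p]).localTamagawaNumber ℤ_[p] →
      (∀ (q' : ℕ) [Fact q'.Prime], q' ∣ N →
        p ∣ (W.baseChange ℚ_[q']).localTamagawaNumber ℤ_[q'] → ¬ q' ^ 2 ∣ N) →
      ∀ {P : (W.baseChange K).toAffine.Point}, IsHeegnerPoint N W K P → ¬ IsOfFinAddOrder P →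
      ∀ (q : ℕ) [Fact q.Prime], q ∣ N → ¬ q ^ 2 ∣ N → q ≠ p →
      padicValNat p (Nat.card (AddCommGroup.primaryComponent (W.baseChange K).sha p)) +
          2 * padicValNat p ((W.baseChange ℚ_[q]).localTamagawaNumber ℤ_[q]) ≤
        2 * padicValNat p (AddSubgroup.zmultiples P).index)
    {W : WeierstrassCurve ℚ} [W.IsElliptic] [W.IsGloballyMinimal] (hWeq : W = (⟨1, (-1), 1, (-463430), 97290197⟩ : WeierstrassCurve ℚ))
    (hN : W.conductorNorm ℤ = 228150) (hr : W.analyticRank = 0)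
    (D : ModularParametrizationData W 228150) (hopt : ∀ z ∈ D.L.lattice, ∃ w ∈ periodLattice D.f, z = (D.c : ℂ) * w)
    (hc : ¬ (3 : ℤ) ∣ D.c)
    (K : Type) [Field K] [NumberField K] (hK : IsImaginaryQuadratic K) (hdK : NumberField.discr K = -191)
    {Wd : WeierstrassCurve ℚ} [Wd.IsElliptic] [Wd.IsGloballyMinimal] (hWdeq : Wd = (⟨1, (-1), 1, (-16906378430), (-677094037946803)⟩ : WeierstrassCurve ℚ))
    (hrd : Wd.analyticRank = 1) {qd : ℚ} (hqd : shaAn Wd = (qd : ℂ)) (hvd : padicValRat 3 qd ≤ 0) :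
    MissingUpperBoundAt W 3 := by
  have hI : integralModelInt W = (⟨1, -1, 1, -463430, 97290197⟩ : WeierstrassCurve ℤ) := by
    subst hWeq; exact integralModelInt_eq_of_map_eq _ (map_mk_int 1 (-1) 1 (-463430) 97290197)
  have hns : ¬ (∀ n : ℕ, W.HasSurjectiveModNGaloisRep (3 ^ n : ℕ)) := fun h =>
    notSurjThree_g228150bz1 hI (by simpa using h 1)
  exact missingUpperBoundAt_g228150bz1_3_tam hGZ hKo hMN hGZK hmod hJ2 hWeq hN hr hns D hopt hc K hK hdK hWdeq hrd hqd hvd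

/-! ### `237600el1`: `Δ = 209584584000000000 = (594000)³` — mod-3 image inside a Cartan normaliser, certified in the kernel -/

/-- **`ρ̄_(E,3)` is NOT surjective for `E = 237600el1`** (kernel: `Δ(E) = (594000)³` on the integral model `[0, 0, 0, -351000, 76950000]`; Serre: `ℚ(E[3]) ⊇ ℚ(μ₃, ∛Δ)`, so a
surjective image forces `Δ ∉ ℚ׳`; tree THEOREM `ModThreeImage.not_hasSurjectiveModNGaloisRep_three_of_Δ_eq_cube`). [cite: Serre1972, §5.3]
[cite: SilvermanAEC2009, III.1] [cite: Cremona2006, Table 1 (Cremona label 237600el1)] -/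
theorem notSurjThree_g237600el1 {W : WeierstrassCurve ℚ} [W.IsElliptic] [W.IsGloballyMinimal]
    (hI : integralModelInt W = (⟨0, 0, 0, -351000, 76950000⟩ : WeierstrassCurve ℤ)) : ¬ W.HasSurjectiveModNGaloisRep 3 := by
  have hD : discOf [0, 0, 0, (-351000), 76950000] = 209584584000000000 := by decide +kernel
  have hΔ : W.Δ = ((209584584000000000 : ℤ) : ℚ) := by rw [Δ_eq_cast hI, intCurve_Δ, hD]
  exact ModThreeImage.not_hasSurjectiveModNGaloisRep_three_of_Δ_eq_cube W (d := ((594000 : ℤ) : ℚ)) (by rw [hΔ]; norm_num)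

/-- **RECORD `237600el1` @ `3` with the image binder `hns` AND the Tamagawa binders DISCHARGED** — `missingUpperBoundAt_g237600el1_3_tam` (file
`…RecordsSharpTam07`) with `hns` supplied by `notSurjThree_g237600el1` (`n = 1`). Remaining displayed: named facts + schema, Cremona's `N`, `r_an = 0`,
the lattice-optimal datum with `3 ∤ c(D)`, the field, the twist numerics. Per pair; nothing booked; BSD is not proved by this.
[cite: Serre1972, §5.3] [cite: Jetchev2008, Cor. 1.5] [cite: Miller2011LMS, Def. 1.1] [cite: Cremona2006, Table 1 (Cremona label 237600el1)] -/
theorem missingUpperBoundAt_g237600el1_3_img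
    (hGZ : ∀ (N : ℕ) [NeZero N] (W : WeierstrassCurve ℚ) (K : Type) [Field K] [NumberField K],
      gross_zagier N W K)
    (hKo : ∀ (N : ℕ) [NeZero N] (W : WeierstrassCurve ℚ) (K : Type) [Field K] [NumberField K],
      kolyvagin N W K)
    (hMN : ∀ (N : ℕ) [NeZero N] (W : WeierstrassCurve ℚ) (K : Type) [Field K] [NumberField K],
      MatarNekovar2019.thm03_padicValNat_card_sha_le_of_irreducible N W K)
    (hGZK : rank_eq_analyticRank_of_analyticRank_le_one) (hmod : hasEntireLFunction_rat)
    (hJ2 : ∀ (N : ℕ) [NeZero N] (W : WeierstrassCurve ℚ) [W.IsElliptic] [W.IsGloballyMinimal]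
      (K : Type) [Field K] [NumberField K],
      IsImaginaryQuadratic K → NumberField.discr K ≠ -3 → NumberField.discr K ≠ -4 →
      SatisfiesHeegnerHypothesis N K → SatisfiesHeegnerHypothesis 2 K →
      ∀ (p : ℕ) [Fact p.Prime], p ≠ 2 → W.analyticRank = 0 → Addv W p → 0 ≤ padicValRat p W.j →
      ¬ W.HasCM → W.HasIrreducibleModPGaloisRep p →
      ¬ (∀ n : ℕ, W.HasSurjectiveModNGaloisRep (p ^ n : ℕ)) →
      (∃ Dt : ModularParametrizationData W N,
        (∀ z ∈ Dt.L.lattice, ∃ w ∈ periodLattice Dt.f, z = (Dt.c : ℂ) * w) ∧ ¬ (p : ℤ) ∣ Dt.c) →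
      ¬ p ∣ (W.baseChange ℚ_[p]).localTamagawaNumber ℤ_[p] →
      (∀ (q' : ℕ) [Fact q'.Prime], q' ∣ N →
        p ∣ (W.baseChange ℚ_[q']).localTamagawaNumber ℤ_[q'] → ¬ q' ^ 2 ∣ N) →
      ∀ {P : (W.baseChange K).toAffine.Point}, IsHeegnerPoint N W K P → ¬ IsOfFinAddOrder P →
      ∀ (q : ℕ) [Fact q.Prime], q ∣ N → ¬ q ^ 2 ∣ N → q ≠ p →
      padicValNat p (Nat.card (AddCommGroup.primaryComponent (W.baseChange K).sha p)) +
          2 * padicValNat p ((W.baseChange ℚ_[q]).localTamagawaNumber ℤ_[q]) ≤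
        2 * padicValNat p (AddSubgroup.zmultiples P).index)
    {W : WeierstrassCurve ℚ} [W.IsElliptic] [W.IsGloballyMinimal] (hWeq : W = (⟨0, 0, 0, (-351000), 76950000⟩ : WeierstrassCurve ℚ))
    (hN : W.conductorNorm ℤ = 237600) (hr : W.analyticRank = 0)
    (D : ModularParametrizationData W 237600) (hopt : ∀ z ∈ D.L.lattice, ∃ w ∈ periodLattice D.f, z = (D.c : ℂ) * w)
    (hc : ¬ (3 : ℤ) ∣ D.c)
    (K : Type) [Field K] [NumberField K] (hK : IsImaginaryQuadratic K) (hdK : NumberField.discr K = -239)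
    {Wd : WeierstrassCurve ℚ} [Wd.IsElliptic] [Wd.IsGloballyMinimal] (hWdeq : Wd = (⟨0, 0, 0, (-20049471000), (-1050515167050000)⟩ : WeierstrassCurve ℚ))
    (hrd : Wd.analyticRank = 1) {qd : ℚ} (hqd : shaAn Wd = (qd : ℂ)) (hvd : padicValRat 3 qd ≤ 0) :
    MissingUpperBoundAt W 3 := by
  have hI : integralModelInt W = (⟨0, 0, 0, -351000, 76950000⟩ : WeierstrassCurve ℤ) := by
    subst hWeq; exact integralModelInt_eq_of_map_eq _ (map_mk_int 0 0 0 (-351000) 76950000)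
  have hns : ¬ (∀ n : ℕ, W.HasSurjectiveModNGaloisRep (3 ^ n : ℕ)) := fun h =>
    notSurjThree_g237600el1 hI (by simpa using h 1)
  exact missingUpperBoundAt_g237600el1_3_tam hGZ hKo hMN hGZK hmod hJ2 hWeq hN hr hns D hopt hc K hK hdK hWdeq hrd hqd hvd

/-! ### `241758cd1`: `Δ = -1203651030739008158208 = (-10637352)³` — mod-3 image inside a Cartan normaliser, certified in the kernel -/

/-- **`ρ̄_(E,3)` is NOT surjective for `E = 241758cd1`** (kernel: `Δ(E) = (-10637352)³` on the integral model `[1, -1, 1, -10410500, -13033423961]`; Serre: `ℚ(E[3]) ⊇ ℚ(μ₃, ∛Δ)`, so a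
surjective image forces `Δ ∉ ℚ׳`; tree THEOREM `ModThreeImage.not_hasSurjectiveModNGaloisRep_three_of_Δ_eq_cube`). [cite: Serre1972, §5.3]
[cite: SilvermanAEC2009, III.1] [cite: Cremona2006, Table 1 (Cremona label 241758cd1)] -/
theorem notSurjThree_g241758cd1 {W : WeierstrassCurve ℚ} [W.IsElliptic] [W.IsGloballyMinimal]
    (hI : integralModelInt W = (⟨1, -1, 1, -10410500, -13033423961⟩ : WeierstrassCurve ℤ)) : ¬ W.HasSurjectiveModNGaloisRep 3 := by
  have hD : discOf [1, (-1), 1, (-10410500), (-13033423961)] = (-1203651030739008158208) := by decide +kernel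
  have hΔ : W.Δ = (((-1203651030739008158208) : ℤ) : ℚ) := by rw [Δ_eq_cast hI, intCurve_Δ, hD]
  exact ModThreeImage.not_hasSurjectiveModNGaloisRep_three_of_Δ_eq_cube W (d := (((-10637352) : ℤ) : ℚ)) (by rw [hΔ]; norm_num)

/-- **RECORD `241758cd1` @ `3` with the image binder `hns` AND the Tamagawa binders DISCHARGED** — `missingUpperBoundAt_g241758cd1_3_tam` (file
`…RecordsSharpTam07`) with `hns` supplied by `notSurjThree_g241758cd1` (`n = 1`). Remaining displayed: named facts + schema, Cremona's `N`, `r_an = 0`,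
the lattice-optimal datum with `3 ∤ c(D)`, the field, the twist numerics. Per pair; nothing booked; BSD is not proved by this.
[cite: Serre1972, §5.3] [cite: Jetchev2008, Cor. 1.5] [cite: Miller2011LMS, Def. 1.1] [cite: Cremona2006, Table 1 (Cremona label 241758cd1)] -/
theorem missingUpperBoundAt_g241758cd1_3_img
    (hGZ : ∀ (N : ℕ) [NeZero N] (W : WeierstrassCurve ℚ) (K : Type) [Field K] [NumberField K],
      gross_zagier N W K)
    (hKo : ∀ (N : ℕ) [NeZero N] (W : WeierstrassCurve ℚ) (K : Type) [Field K] [NumberField K],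
      kolyvagin N W K)
    (hMN : ∀ (N : ℕ) [NeZero N] (W : WeierstrassCurve ℚ) (K : Type) [Field K] [NumberField K],
      MatarNekovar2019.thm03_padicValNat_card_sha_le_of_irreducible N W K)
    (hGZK : rank_eq_analyticRank_of_analyticRank_le_one) (hmod : hasEntireLFunction_rat)
    (hJ2 : ∀ (N : ℕ) [NeZero N] (W : WeierstrassCurve ℚ) [W.IsElliptic] [W.IsGloballyMinimal]
      (K : Type) [Field K] [NumberField K],
      IsImaginaryQuadratic K → NumberField.discr K ≠ -3 → NumberField.discr K ≠ -4 →
      SatisfiesHeegnerHypothesis N K → SatisfiesHeegnerHypothesis 2 K →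
      ∀ (p : ℕ) [Fact p.Prime], p ≠ 2 → W.analyticRank = 0 → Addv W p → 0 ≤ padicValRat p W.j →
      ¬ W.HasCM → W.HasIrreducibleModPGaloisRep p →
      ¬ (∀ n : ℕ, W.HasSurjectiveModNGaloisRep (p ^ n : ℕ)) →
      (∃ Dt : ModularParametrizationData W N,
        (∀ z ∈ Dt.L.lattice, ∃ w ∈ periodLattice Dt.f, z = (Dt.c : ℂ) * w) ∧ ¬ (p : ℤ) ∣ Dt.c) →
      ¬ p ∣ (W.baseChange ℚ_[p]).localTamagawaNumber ℤ_[p] →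
      (∀ (q' : ℕ) [Fact q'.Prime], q' ∣ N →
        p ∣ (W.baseChange ℚ_[q']).localTamagawaNumber ℤ_[q'] → ¬ q' ^ 2 ∣ N) →
      ∀ {P : (W.baseChange K).toAffine.Point}, IsHeegnerPoint N W K P → ¬ IsOfFinAddOrder P →
      ∀ (q : ℕ) [Fact q.Prime], q ∣ N → ¬ q ^ 2 ∣ N → q ≠ p →
      padicValNat p (Nat.card (AddCommGroup.primaryComponent (W.baseChange K).sha p)) +
          2 * padicValNat p ((W.baseChange ℚ_[q]).localTamagawaNumber ℤ_[q]) ≤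
        2 * padicValNat p (AddSubgroup.zmultiples P).index)
    {W : WeierstrassCurve ℚ} [W.IsElliptic] [W.IsGloballyMinimal] (hWeq : W = (⟨1, (-1), 1, (-10410500), (-13033423961)⟩ : WeierstrassCurve ℚ))
    (hN : W.conductorNorm ℤ = 241758) (hr : W.analyticRank = 0)
    (D : ModularParametrizationData W 241758) (hopt : ∀ z ∈ D.L.lattice, ∃ w ∈ periodLattice D.f, z = (D.c : ℂ) * w)
    (hc : ¬ (3 : ℤ) ∣ D.c)
    (K : Type) [Field K] [NumberField K] (hK : IsImaginaryQuadratic K) (hdK : NumberField.discr K = -215)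
    {Wd : WeierstrassCurve ℚ} [Wd.IsElliptic] [Wd.IsGloballyMinimal] (hWdeq : Wd = (⟨1, (-1), 1, (-481225348055), 129557041024558447⟩ : WeierstrassCurve ℚ))
    (hrd : Wd.analyticRank = 1) {qd : ℚ} (hqd : shaAn Wd = (qd : ℂ)) (hvd : padicValRat 3 qd ≤ 0) :
    MissingUpperBoundAt W 3 := by
  have hI : integralModelInt W = (⟨1, -1, 1, -10410500, -13033423961⟩ : WeierstrassCurve ℤ) := by
    subst hWeq; exact integralModelInt_eq_of_map_eq _ (map_mk_int 1 (-1) 1 (-10410500) (-13033423961))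
  have hns : ¬ (∀ n : ℕ, W.HasSurjectiveModNGaloisRep (3 ^ n : ℕ)) := fun h =>
    notSurjThree_g241758cd1 hI (by simpa using h 1)
  exact missingUpperBoundAt_g241758cd1_3_tam hGZ hKo hMN hGZK hmod hJ2 hWeq hN hr hns D hopt hc K hK hdK hWdeq hrd hqd hvd

/-! ### `241758ck1`: `Δ = -932002232832 = (-9768)³` — mod-3 image inside a Cartan normaliser, certified in the kernel -/

/-- **`ρ̄_(E,3)` is NOT surjective for `E = 241758ck1`** (kernel: `Δ(E) = (-9768)³` on the integral model `[1, -1, 1, -9560, -360357]`; Serre: `ℚ(E[3]) ⊇ ℚ(μ₃, ∛Δ)`, so a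
surjective image forces `Δ ∉ ℚ׳`; tree THEOREM `ModThreeImage.not_hasSurjectiveModNGaloisRep_three_of_Δ_eq_cube`). [cite: Serre1972, §5.3]
[cite: SilvermanAEC2009, III.1] [cite: Cremona2006, Table 1 (Cremona label 241758ck1)] -/
theorem notSurjThree_g241758ck1 {W : WeierstrassCurve ℚ} [W.IsElliptic] [W.IsGloballyMinimal]
    (hI : integralModelInt W = (⟨1, -1, 1, -9560, -360357⟩ : WeierstrassCurve ℤ)) : ¬ W.HasSurjectiveModNGaloisRep 3 := by
  have hD : discOf [1, (-1), 1, (-9560), (-360357)] = (-932002232832) := by decide +kernel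
  have hΔ : W.Δ = (((-932002232832) : ℤ) : ℚ) := by rw [Δ_eq_cast hI, intCurve_Δ, hD]
  exact ModThreeImage.not_hasSurjectiveModNGaloisRep_three_of_Δ_eq_cube W (d := (((-9768) : ℤ) : ℚ)) (by rw [hΔ]; norm_num)

/-- **RECORD `241758ck1` @ `3` with the image binder `hns` AND the Tamagawa binders DISCHARGED** — `missingUpperBoundAt_g241758ck1_3_tam` (file
`…RecordsSharpTam08`) with `hns` supplied by `notSurjThree_g241758ck1` (`n = 1`). Remaining displayed: named facts + schema, Cremona's `N`, `r_an = 0`,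
the lattice-optimal datum with `3 ∤ c(D)`, the field, the twist numerics. Per pair; nothing booked; BSD is not proved by this.
[cite: Serre1972, §5.3] [cite: Jetchev2008, Cor. 1.5] [cite: Miller2011LMS, Def. 1.1] [cite: Cremona2006, Table 1 (Cremona label 241758ck1)] -/
theorem missingUpperBoundAt_g241758ck1_3_img
    (hGZ : ∀ (N : ℕ) [NeZero N] (W : WeierstrassCurve ℚ) (K : Type) [Field K] [NumberField K],
      gross_zagier N W K)
    (hKo : ∀ (N : ℕ) [NeZero N] (W : WeierstrassCurve ℚ) (K : Type) [Field K] [NumberField K],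
      kolyvagin N W K)
    (hMN : ∀ (N : ℕ) [NeZero N] (W : WeierstrassCurve ℚ) (K : Type) [Field K] [NumberField K],
      MatarNekovar2019.thm03_padicValNat_card_sha_le_of_irreducible N W K)
    (hGZK : rank_eq_analyticRank_of_analyticRank_le_one) (hmod : hasEntireLFunction_rat)
    (hJ2 : ∀ (N : ℕ) [NeZero N] (W : WeierstrassCurve ℚ) [W.IsElliptic] [W.IsGloballyMinimal]
      (K : Type) [Field K] [NumberField K],
      IsImaginaryQuadratic K → NumberField.discr K ≠ -3 → NumberField.discr K ≠ -4 →
      SatisfiesHeegnerHypothesis N K → SatisfiesHeegnerHypothesis 2 K →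
      ∀ (p : ℕ) [Fact p.Prime], p ≠ 2 → W.analyticRank = 0 → Addv W p → 0 ≤ padicValRat p W.j →
      ¬ W.HasCM → W.HasIrreducibleModPGaloisRep p →
      ¬ (∀ n : ℕ, W.HasSurjectiveModNGaloisRep (p ^ n : ℕ)) →
      (∃ Dt : ModularParametrizationData W N,
        (∀ z ∈ Dt.L.lattice, ∃ w ∈ periodLattice Dt.f, z = (Dt.c : ℂ) * w) ∧ ¬ (p : ℤ) ∣ Dt.c) →
      ¬ p ∣ (W.baseChange ℚ_[p]).localTamagawaNumber ℤ_[p] →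
      (∀ (q' : ℕ) [Fact q'.Prime], q' ∣ N →
        p ∣ (W.baseChange ℚ_[q']).localTamagawaNumber ℤ_[q'] → ¬ q' ^ 2 ∣ N) →
      ∀ {P : (W.baseChange K).toAffine.Point}, IsHeegnerPoint N W K P → ¬ IsOfFinAddOrder P →
      ∀ (q : ℕ) [Fact q.Prime], q ∣ N → ¬ q ^ 2 ∣ N → q ≠ p →
      padicValNat p (Nat.card (AddCommGroup.primaryComponent (W.baseChange K).sha p)) +
          2 * padicValNat p ((W.baseChange ℚ_[q]).localTamagawaNumber ℤ_[q]) ≤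
        2 * padicValNat p (AddSubgroup.zmultiples P).index)
    {W : WeierstrassCurve ℚ} [W.IsElliptic] [W.IsGloballyMinimal] (hWeq : W = (⟨1, (-1), 1, (-9560), (-360357)⟩ : WeierstrassCurve ℚ))
    (hN : W.conductorNorm ℤ = 241758) (hr : W.analyticRank = 0)
    (D : ModularParametrizationData W 241758) (hopt : ∀ z ∈ D.L.lattice, ∃ w ∈ periodLattice D.f, z = (D.c : ℂ) * w)
    (hc : ¬ (3 : ℤ) ∣ D.c)
    (K : Type) [Field K] [NumberField K] (hK : IsImaginaryQuadratic K) (hdK : NumberField.discr K = -95)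
    {Wd : WeierstrassCurve ℚ} [Wd.IsElliptic] [Wd.IsGloballyMinimal] (hWdeq : Wd = (⟨1, (-1), 1, (-86276180), 311031483447⟩ : WeierstrassCurve ℚ))
    (hrd : Wd.analyticRank = 1) {qd : ℚ} (hqd : shaAn Wd = (qd : ℂ)) (hvd : padicValRat 3 qd ≤ 0) :
    MissingUpperBoundAt W 3 := by
  have hI : integralModelInt W = (⟨1, -1, 1, -9560, -360357⟩ : WeierstrassCurve ℤ) := by
    subst hWeq; exact integralModelInt_eq_of_map_eq _ (map_mk_int 1 (-1) 1 (-9560) (-360357))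
  have hns : ¬ (∀ n : ℕ, W.HasSurjectiveModNGaloisRep (3 ^ n : ℕ)) := fun h =>
    notSurjThree_g241758ck1 hI (by simpa using h 1)
  exact missingUpperBoundAt_g241758ck1_3_tam hGZ hKo hMN hGZK hmod hJ2 hWeq hN hr hns D hopt hc K hK hdK hWdeq hrd hqd hvd

/-! ### `249615i1`: `Δ = 1696250065286845125 = (1192605)³` — mod-3 image inside a Cartan normaliser, certified in the kernel -/

/-- **`ρ̄_(E,3)` is NOT surjective for `E = 249615i1`** (kernel: `Δ(E) = (1192605)³` on the integral model `[0, 0, 1, -477042, 110256332]`; Serre: `ℚ(E[3]) ⊇ ℚ(μ₃, ∛Δ)`, so a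
surjective image forces `Δ ∉ ℚ׳`; tree THEOREM `ModThreeImage.not_hasSurjectiveModNGaloisRep_three_of_Δ_eq_cube`). [cite: Serre1972, §5.3]
[cite: SilvermanAEC2009, III.1] [cite: Cremona2006, Table 1 (Cremona label 249615i1)] -/
theorem notSurjThree_g249615i1 {W : WeierstrassCurve ℚ} [W.IsElliptic] [W.IsGloballyMinimal]
    (hI : integralModelInt W = (⟨0, 0, 1, -477042, 110256332⟩ : WeierstrassCurve ℤ)) : ¬ W.HasSurjectiveModNGaloisRep 3 := by
  have hD : discOf [0, 0, 1, (-477042), 110256332] = 1696250065286845125 := by decide +kernel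
  have hΔ : W.Δ = ((1696250065286845125 : ℤ) : ℚ) := by rw [Δ_eq_cast hI, intCurve_Δ, hD]
  exact ModThreeImage.not_hasSurjectiveModNGaloisRep_three_of_Δ_eq_cube W (d := ((1192605 : ℤ) : ℚ)) (by rw [hΔ]; norm_num)

/-- **RECORD `249615i1` @ `3` with the image binder `hns` AND the Tamagawa binders DISCHARGED** — `missingUpperBoundAt_g249615i1_3_tam` (file
`…RecordsSharpTam08`) with `hns` supplied by `notSurjThree_g249615i1` (`n = 1`). Remaining displayed: named facts + schema, Cremona's `N`, `r_an = 0`,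
the lattice-optimal datum with `3 ∤ c(D)`, the field, the twist numerics. Per pair; nothing booked; BSD is not proved by this.
[cite: Serre1972, §5.3] [cite: Jetchev2008, Cor. 1.5] [cite: Miller2011LMS, Def. 1.1] [cite: Cremona2006, Table 1 (Cremona label 249615i1)] -/
theorem missingUpperBoundAt_g249615i1_3_img
    (hGZ : ∀ (N : ℕ) [NeZero N] (W : WeierstrassCurve ℚ) (K : Type) [Field K] [NumberField K],
      gross_zagier N W K)
    (hKo : ∀ (N : ℕ) [NeZero N] (W : WeierstrassCurve ℚ) (K : Type) [Field K] [NumberField K],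
      kolyvagin N W K)
    (hMN : ∀ (N : ℕ) [NeZero N] (W : WeierstrassCurve ℚ) (K : Type) [Field K] [NumberField K],
      MatarNekovar2019.thm03_padicValNat_card_sha_le_of_irreducible N W K)
    (hGZK : rank_eq_analyticRank_of_analyticRank_le_one) (hmod : hasEntireLFunction_rat)
    (hJ2 : ∀ (N : ℕ) [NeZero N] (W : WeierstrassCurve ℚ) [W.IsElliptic] [W.IsGloballyMinimal]
      (K : Type) [Field K] [NumberField K],
      IsImaginaryQuadratic K → NumberField.discr K ≠ -3 → NumberField.discr K ≠ -4 →
      SatisfiesHeegnerHypothesis N K → SatisfiesHeegnerHypothesis 2 K →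
      ∀ (p : ℕ) [Fact p.Prime], p ≠ 2 → W.analyticRank = 0 → Addv W p → 0 ≤ padicValRat p W.j →
      ¬ W.HasCM → W.HasIrreducibleModPGaloisRep p →
      ¬ (∀ n : ℕ, W.HasSurjectiveModNGaloisRep (p ^ n : ℕ)) →
      (∃ Dt : ModularParametrizationData W N,
        (∀ z ∈ Dt.L.lattice, ∃ w ∈ periodLattice Dt.f, z = (Dt.c : ℂ) * w) ∧ ¬ (p : ℤ) ∣ Dt.c) →
      ¬ p ∣ (W.baseChange ℚ_[p]).localTamagawaNumber ℤ_[p] →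
      (∀ (q' : ℕ) [Fact q'.Prime], q' ∣ N →
        p ∣ (W.baseChange ℚ_[q']).localTamagawaNumber ℤ_[q'] → ¬ q' ^ 2 ∣ N) →
      ∀ {P : (W.baseChange K).toAffine.Point}, IsHeegnerPoint N W K P → ¬ IsOfFinAddOrder P →
      ∀ (q : ℕ) [Fact q.Prime], q ∣ N → ¬ q ^ 2 ∣ N → q ≠ p →
      padicValNat p (Nat.card (AddCommGroup.primaryComponent (W.baseChange K).sha p)) +
          2 * padicValNat p ((W.baseChange ℚ_[q]).localTamagawaNumber ℤ_[q]) ≤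
        2 * padicValNat p (AddSubgroup.zmultiples P).index)
    {W : WeierstrassCurve ℚ} [W.IsElliptic] [W.IsGloballyMinimal] (hWeq : W = (⟨0, 0, 1, (-477042), 110256332⟩ : WeierstrassCurve ℚ))
    (hN : W.conductorNorm ℤ = 249615) (hr : W.analyticRank = 0)
    (D : ModularParametrizationData W 249615) (hopt : ∀ z ∈ D.L.lattice, ∃ w ∈ periodLattice D.f, z = (D.c : ℂ) * w)
    (hc : ¬ (3 : ℤ) ∣ D.c)
    (K : Type) [Field K] [NumberField K] (hK : IsImaginaryQuadratic K) (hdK : NumberField.discr K = -119)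
    {Wd : WeierstrassCurve ℚ} [Wd.IsElliptic] [Wd.IsGloballyMinimal] (hWdeq : Wd = (⟨0, 0, 1, (-6755391762), (-185799450598078)⟩ : WeierstrassCurve ℚ))
    (hrd : Wd.analyticRank = 1) {qd : ℚ} (hqd : shaAn Wd = (qd : ℂ)) (hvd : padicValRat 3 qd ≤ 0) :
    MissingUpperBoundAt W 3 := by
  have hI : integralModelInt W = (⟨0, 0, 1, -477042, 110256332⟩ : WeierstrassCurve ℤ) := by
    subst hWeq; exact integralModelInt_eq_of_map_eq _ (map_mk_int 0 0 1 (-477042) 110256332)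
  have hns : ¬ (∀ n : ℕ, W.HasSurjectiveModNGaloisRep (3 ^ n : ℕ)) := fun h =>
    notSurjThree_g249615i1 hI (by simpa using h 1)
  exact missingUpperBoundAt_g249615i1_3_tam hGZ hKo hMN hGZK hmod hJ2 hWeq hN hr hns D hopt hc K hK hdK hWdeq hrd hqd hvd

end Summit.BirchSwinnertonDyer.BirchSwinnertonDyer.Theorems.WildUpperUnitTwistRecords

end
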